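import Literature.NumberTheory.Sieve.ConvexBodyLatticePoints
import Literature.NumberTheory.Sieve.LinearEquationsInPrimesProofs
import Mathlib.NumberTheory.ArithmeticFunction.Moebius
import Mathlib.Analysis.SpecialFunctions.Log.Basic
import Mathlib.Algebra.BigOperators.Expect
import Mathlib.MeasureTheory.Measure.Lebesgue.EqHaar
import HarnessLib

/-!
# The enveloping sieve: truncated divisor sums and local densities (Green–Tao 2010, App. D)

Trunk T-SIEVE (`Literature/NumberTheory/Sieve`). First file of the App. D layer of the
decomposition of `Literature.NumberTheory.Sieve.GreenTaoZiegler2012_finiteComplexity`, towards the discharge of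
`Literature.NumberTheory.Sieve.GreenTao2010_pseudorandomDomination` (Prop. 6.4 of B. Green, T. Tao, *Linear equations in
primes*, Ann. of Math. 171 (2010), proved in App. D from the Goldston–Yıldırım estimate,
Thm. D.3). This file contains the combinatorial preliminaries of the proof of Thm. D.3 (p. 44 of
arXiv:math/0606088):

* the truncated divisor sums `Λ_{χ,R,a}(n) = log R (∑_{e | n} μ(e) χ(log e / log R))^a`
  (`Literature.NumberTheory.Sieve.truncDivisorSum`), defined and periodic on all of `ℤ`;
* the expansion of `∑_{n} ∏_i Λ_{χ_i,R,a_i}(ψ_i(n))` over the index set `Ω = {(i,j) : j ∈ [a_i]}`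
  with the moduli `m_i = lcm_j e_{i,j}` (`Literature.NumberTheory.Sieve.sum_prod_truncDivisorSum_eq`);
* volume packing: for a weight `w` on `ℤ_m^d` and a convex body `K ⊆ [-N,N]^d`,
  `∑_{K ∩ ℤ^d} w(n mod m) = vol(K) 𝔼 w + O_d(m^d (N/m + 2)^{d-1})` (`Literature.NumberTheory.Sieve.sum_periodic_weight`, from
  `Literature.NumberTheory.Sieve.GreenTao2010_latticePointsConvexBody_holds` applied to the rescaled residue bodies), and
  the resulting `∑_{K ∩ ℤ^d} ∏_i 1_{m_i | ψ_i(n)} = vol(K) α_{m_1,…,m_t} + O(…)`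
  (`Literature.NumberTheory.Sieve.sum_divisibility_eq_volume`) with the local densities `Literature.NumberTheory.Sieve.localDensity`;
* the multiplicativity of the local densities in coprime moduli (`Literature.NumberTheory.Sieve.localDensity_mul`, by the
  Chinese remainder theorem).

## References

* B. Green, T. Tao, *Linear equations in primes*, Ann. of Math. (2) 171 (2010), 1753–1850
  (arXiv:math/0606088), App. D: definition of `Λ_{χ,R,a}`, Thm. D.3 and the first page of its
  proof (expansion, `m_i := lcm`, volume packing, `α_{m_1,…,m_t}`, multiplicativity).
-/

noncomputable section

open Finset MeasureTheory
open scoped BigOperators ArithmeticFunction.Moebius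

namespace Literature.NumberTheory.Sieve

/-! ### Truncated divisor sums (Green–Tao 2010, App. D) -/

section truncdiv

/-- The smoothly truncated Möbius divisor sum
`∑_{e | n} μ(e) χ(log e / log R)`, the sum over `1 ≤ e ≤ ⌊R⌋` (all of the support of `χ(log · / log R)`
when `supp χ ⊆ [-1, 1]`); in particular it is defined, and periodic, on all of `ℤ`
("we extend `Λ_{χ,R,a}` to the negative numbers in the obvious manner").
[cite: GreenTao2010, App. D (definition of `Λ_{χ,R,a}`)] -/
def moebiusDivisorSum (χ : ℝ → ℝ) (R : ℝ) (n : ℤ) : ℝ :=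
  ∑ e ∈ (Finset.Icc 1 ⌊R⌋₊).filter (fun e : ℕ => (e : ℤ) ∣ n),
    (ArithmeticFunction.moebius e : ℝ) * χ (Real.log e / Real.log R)

/-- The truncated divisor sum `Λ_{χ,R,a}(n) = log R · (∑_{e | n} μ(e) χ(log e / log R))^a`.
[cite: GreenTao2010, App. D (definition of `Λ_{χ,R,a}`)] -/
def truncDivisorSum (χ : ℝ → ℝ) (R : ℝ) (a : ℕ) (n : ℤ) : ℝ :=
  Real.log R * moebiusDivisorSum χ R n ^ a

/-- The weight `g(e) = μ(e) χ(log e / log R)` of a single divisor. [folklore] -/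
def moebiusWeight (χ : ℝ → ℝ) (R : ℝ) (e : ℕ) : ℝ :=
  (ArithmeticFunction.moebius e : ℝ) * χ (Real.log e / Real.log R)

/-- Expanding the `a`-th power: `(∑_{e | n} g(e))^a = ∑_{(e_j) ∈ [1,R]^a} ∏_j g(e_j) 1_{e_j | n}`,
and `∏_j 1_{e_j | n} = 1_{lcm_j e_j | n}`. [cite: GreenTao2010, App. D (proof of Thm. D.3, first
two displays)] -/
theorem moebiusDivisorSum_pow (χ : ℝ → ℝ) (R : ℝ) (a : ℕ) (n : ℤ) :
    moebiusDivisorSum χ R n ^ a =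
      ∑ e ∈ Fintype.piFinset (fun _ : Fin a => Finset.Icc 1 ⌊R⌋₊),
        (∏ j, moebiusWeight χ R (e j)) *
          if ((Finset.univ : Finset (Fin a)).lcm (fun j => (e j : ℤ))) ∣ n then 1 else 0 := by
  classical
  unfold moebiusDivisorSum
  rw [Finset.sum_filter, Finset.pow_eq_prod_const, ← Fin.prod_univ_eq_prod_range (fun _ =>
    ∑ e ∈ Finset.Icc 1 ⌊R⌋₊, if (e : ℤ) ∣ n then
      (ArithmeticFunction.moebius e : ℝ) * χ (Real.log e / Real.log R) else 0) a,
    Finset.prod_univ_sum]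
  refine Finset.sum_congr rfl fun e _ => ?_
  rw [Finset.prod_ite_zero]
  unfold moebiusWeight
  by_cases h : ∀ j ∈ (Finset.univ : Finset (Fin a)), ((e j : ℕ) : ℤ) ∣ n
  · rw [if_pos (by simpa using h), if_pos (Finset.lcm_dvd_iff.mpr h), mul_one]
  · rw [if_neg (by simpa using h), if_neg (fun h' => h (Finset.lcm_dvd_iff.mp h')), mul_zero]

/-- The moduli `m_i = lcm_j e_{i,j}` of an index `e ∈ ℕ^Ω`. [cite: GreenTao2010, App. D (proof of
Thm. D.3, "`m_i := lcm(m_{i,1},…,m_{i,a_i})`")] -/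
def lcmIdx {t : ℕ} {a : Fin t → ℕ} (e : (i : Fin t) → Fin (a i) → ℕ) (i : Fin t) : ℕ :=
  (Finset.univ : Finset (Fin (a i))).lcm (e i)

/-- The integer cast of `lcmIdx` is the `lcm` of the casts. [folklore] -/
theorem natCast_lcmIdx {t : ℕ} {a : Fin t → ℕ} (e : (i : Fin t) → Fin (a i) → ℕ) (i : Fin t) (n : ℤ) :
    ((lcmIdx e i : ℕ) : ℤ) ∣ n ↔ (Finset.univ : Finset (Fin (a i))).lcm (fun j => (e i j : ℤ)) ∣ n := by
  unfold lcmIdx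
  rw [Finset.lcm_dvd_iff, Int.natCast_dvd, Finset.lcm_dvd_iff]
  simp only [Finset.mem_univ, forall_true_left]
  constructor
  · intro h j; exact Int.natCast_dvd.mpr (by exact_mod_cast h j)
  · intro h j
    have := h j
    rw [Int.natCast_dvd] at this
    exact_mod_cast this

variable {d t : ℕ}

/-- **Expanding the product of truncated divisor sums** (first reduction in the proof of
Thm. D.3): `∑_{n ∈ A} ∏_i Λ_{χ_i,R,a_i}(ψ_i(n)) = log^t R ∑_{e ∈ [1,R]^Ω} (∏_{(i,j)} μ(e_{i,j}) χ_i(log e_{i,j}/log R))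
∑_{n ∈ A} ∏_i 1_{m_i | ψ_i(n)}` with `m_i = lcm_j e_{i,j}`.
[cite: GreenTao2010, App. D (proof of Thm. D.3, first two displays)] -/
theorem sum_prod_truncDivisorSum_eq (A : Finset (Fin d → ℤ)) (Ψ : Fin t → AffLinForm d)
    (χ : Fin t → ℝ → ℝ) (R : ℝ) (a : Fin t → ℕ) :
    ∑ n ∈ A, ∏ i, truncDivisorSum (χ i) R (a i) ((Ψ i).eval n) =
      Real.log R ^ t *
        ∑ e ∈ Fintype.piFinset (fun i : Fin t => Fintype.piFinset (fun _ : Fin (a i) => Finset.Icc 1 ⌊R⌋₊)),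
          (∏ i, ∏ j, moebiusWeight (χ i) R (e i j)) *
            ∑ n ∈ A, ∏ i, if ((lcmIdx e i : ℕ) : ℤ) ∣ (Ψ i).eval n then (1 : ℝ) else 0 := by
  classical
  -- pointwise expansion
  have hpt : ∀ n : Fin d → ℤ, ∏ i, truncDivisorSum (χ i) R (a i) ((Ψ i).eval n) =
      Real.log R ^ t * ∑ e ∈ Fintype.piFinset
        (fun i : Fin t => Fintype.piFinset (fun _ : Fin (a i) => Finset.Icc 1 ⌊R⌋₊)),
        (∏ i, ∏ j, moebiusWeight (χ i) R (e i j)) *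
          ∏ i, if ((lcmIdx e i : ℕ) : ℤ) ∣ (Ψ i).eval n then (1 : ℝ) else 0 := by
    intro n
    unfold truncDivisorSum
    rw [Finset.prod_mul_distrib, Finset.prod_const, Finset.card_univ, Fintype.card_fin]
    congr 1
    simp_rw [moebiusDivisorSum_pow]
    rw [Finset.prod_univ_sum]
    refine Finset.sum_congr rfl fun e _ => ?_
    rw [Finset.prod_mul_distrib]
    congr 1
    refine Fintype.prod_congr _ _ fun i => ?_
    by_cases h : ((lcmIdx e i : ℕ) : ℤ) ∣ (Ψ i).eval n
    · rw [if_pos h, if_pos ((natCast_lcmIdx e i _).mp h)]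
    · rw [if_neg h, if_neg (fun h' => h ((natCast_lcmIdx e i _).mpr h'))]
  simp_rw [hpt]
  rw [← Finset.mul_sum, Finset.sum_comm]
  congr 1
  refine Finset.sum_congr rfl fun e _ => ?_
  rw [Finset.mul_sum]

end truncdiv


/-! ### Volume packing for periodic weights (Green–Tao 2010, App. D) -/

section volpacking

variable {d : ℕ}

/-- The body `K_r = {x : r + m x ∈ K}` of a residue class. [folklore] -/
def residueBody (K : Set (Fin d → ℝ)) (m : ℕ) (r : Fin d → ℤ) : Set (Fin d → ℝ) :=
  {x | (fun j => (r j : ℝ) + (m : ℝ) * x j) ∈ K}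

/-- `K_r` is convex. [folklore] -/
theorem convex_residueBody {K : Set (Fin d → ℝ)} (hK : Convex ℝ K) (m : ℕ) (r : Fin d → ℤ) :
    Convex ℝ (residueBody K m r) := by
  intro x hx y hy a b ha hb hab
  show (fun j => (r j : ℝ) + (m : ℝ) * (a • x + b • y) j) ∈ K
  have : (fun j => (r j : ℝ) + (m : ℝ) * (a • x + b • y) j) =
      a • (fun j => (r j : ℝ) + (m : ℝ) * x j) + b • (fun j => (r j : ℝ) + (m : ℝ) * y j) := by
    funext j
    simp only [Pi.add_apply, Pi.smul_apply, smul_eq_mul]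
    linear_combination (-(r j : ℝ)) * hab
  rw [this]; exact hK hx hy ha hb hab

/-- `K_r ⊆ [-(N/m + 2), N/m + 2]^d` for `K ⊆ [-N,N]^d` and `0 ≤ r < m`. [folklore] -/
theorem residueBody_subset {K : Set (Fin d → ℝ)} {N m : ℕ} (hm : 1 ≤ m) (hKN : K ⊆ realBox d N)
    {r : Fin d → ℤ} (hr : ∀ j, 0 ≤ r j ∧ r j < m) :
    residueBody K m r ⊆ realBox d ((N / m + 2 : ℕ) : ℝ) := by
  intro x hx
  have hmr : (0 : ℝ) < m := by exact_mod_cast hm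
  have hdiv : (N : ℝ) / m ≤ ((N / m : ℕ) : ℝ) + 1 := by
    rw [div_le_iff₀ hmr]
    have h' : ((N : ℕ) : ℝ) < ((N / m * m + m : ℕ) : ℝ) := by exact_mod_cast Nat.lt_div_mul_add hm
    push_cast at h'
    nlinarith
  have hb := hKN hx
  constructor
  · intro j
    have h1 : -(N : ℝ) ≤ (r j : ℝ) + (m : ℝ) * x j := hb.1 j
    have h2 : ((r j : ℤ) : ℝ) < m := by exact_mod_cast (hr j).2
    show -(((N / m + 2 : ℕ) : ℝ)) ≤ x j
    push_cast
    have : -((N : ℝ) / m) - 1 ≤ x j := by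
      have h3 : -(N : ℝ) - m ≤ (m : ℝ) * x j := by linarith
      have h4 : (-((N : ℝ) / m) - 1) * m = -(N : ℝ) - m := by field_simp
      have h5 : (-((N : ℝ) / m) - 1) * m ≤ x j * m := by rw [h4]; linarith
      exact le_of_mul_le_mul_right h5 hmr
    linarith
  · intro j
    have h1 : (r j : ℝ) + (m : ℝ) * x j ≤ N := hb.2 j
    have h2 : (0 : ℝ) ≤ ((r j : ℤ) : ℝ) := by exact_mod_cast (hr j).1
    show x j ≤ ((N / m + 2 : ℕ) : ℝ)
    push_cast
    have : x j ≤ (N : ℝ) / m := by rw [le_div_iff₀ hmr]; nlinarith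
    linarith

/-- `vol(K_r) = vol(K) / m^d`. [folklore] -/
theorem volume_residueBody (K : Set (Fin d → ℝ)) {m : ℕ} (hm : 1 ≤ m) (r : Fin d → ℤ) :
    volume (residueBody K m r) = ENNReal.ofReal (((m : ℝ) ^ d)⁻¹) * volume K := by
  have hset : residueBody K m r =
      (fun x : Fin d → ℝ => (m : ℝ) • x) ⁻¹' ((fun y : Fin d → ℝ => (fun j => (r j : ℝ)) + y) ⁻¹' K) := by
    ext x
    simp only [residueBody, Set.mem_setOf_eq, Set.mem_preimage]
    rfl
  rw [hset, Measure.addHaar_preimage_smul volume (by exact_mod_cast (show m ≠ 0 by omega) : (m : ℝ) ≠ 0),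
    measure_preimage_add, Module.finrank_fin_fun, abs_inv, abs_of_nonneg (by positivity)]

open Classical in
/-- The residue classes biject with the lattice points of `K_r`. [folklore] -/
theorem card_filter_residue_eq {K : Set (Fin d → ℝ)} {N m : ℕ} (hm : 1 ≤ m) (hKN : K ⊆ realBox d N)
    (r : Fin d → ZMod m) :
    (((latticeBox d N).filter fun n => realPoint n ∈ K).filter
        fun n => (fun j => ((n j : ℤ) : ZMod m)) = r).card =
      ((latticeBox d (N / m + 2)).filter fun k =>
        realPoint k ∈ residueBody K m (fun j => ((r j).val : ℤ))).card := by
  haveI : NeZero m := ⟨by omega⟩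
  set r₀ : Fin d → ℤ := fun j => ((r j).val : ℤ) with hr₀
  have hr : ∀ j, 0 ≤ r₀ j ∧ r₀ j < m := fun j => by
    show (0 : ℤ) ≤ ((r j).val : ℤ) ∧ (((r j).val : ℤ)) < m
    exact ⟨Int.natCast_nonneg _, by exact_mod_cast ZMod.val_lt (r j)⟩
  symm
  refine Finset.card_bij (fun k _ => fun j => r₀ j + m * k j) ?_ ?_ ?_
  · intro k hk
    have hkK := (Finset.mem_filter.mp hk).2
    have hnK : realPoint (fun j => r₀ j + m * k j) ∈ K := by
      have : realPoint (fun j => r₀ j + (m : ℤ) * k j) = fun j => (r₀ j : ℝ) + (m : ℝ) * (realPoint k) j := by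
        funext j; simp [realPoint]
      rw [this]; exact hkK
    refine Finset.mem_filter.mpr ⟨Finset.mem_filter.mpr ⟨?_, hnK⟩, ?_⟩
    · refine Fintype.mem_piFinset.mpr fun j => Finset.mem_Icc.mpr ?_
      have h1 : (-(N : ℝ)) ≤ ((r₀ j + m * k j : ℤ) : ℝ) := (hKN hnK).1 j
      have h2 : ((r₀ j + m * k j : ℤ) : ℝ) ≤ N := (hKN hnK).2 j
      exact ⟨by exact_mod_cast h1, by exact_mod_cast h2⟩
    · funext j
      push_cast
      rw [ZMod.natCast_self, zero_mul, add_zero]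
      show ((((r j).val : ℤ)) : ZMod m) = r j
      rw [Int.cast_natCast, ZMod.natCast_zmod_val]
  · intro k _ k' _ hkk'
    funext j
    have : r₀ j + (m : ℤ) * k j = r₀ j + (m : ℤ) * k' j := congr_fun hkk' j
    have hm0 : (m : ℤ) ≠ 0 := by exact_mod_cast (show m ≠ 0 by omega)
    exact mul_left_cancel₀ hm0 (by linarith)
  · intro n hn
    obtain ⟨hn1, hn2⟩ := Finset.mem_filter.mp hn
    have hnK := (Finset.mem_filter.mp hn1).2
    have hdvd : ∀ j, (m : ℤ) ∣ n j - r₀ j := fun j => by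
      have : ((n j : ℤ) : ZMod m) = r j := congr_fun hn2 j
      rw [← ZMod.intCast_eq_intCast_iff_dvd_sub, this]
      show ((((r j).val : ℤ)) : ZMod m) = r j
      rw [Int.cast_natCast, ZMod.natCast_zmod_val]
    refine ⟨fun j => (n j - r₀ j) / m, ?_, ?_⟩
    · have hk : (fun j => r₀ j + (m : ℤ) * ((n j - r₀ j) / m)) = n := by
        funext j; rw [Int.mul_ediv_cancel' (hdvd j)]; ring
      have hkK : realPoint (fun j => (n j - r₀ j) / m) ∈ residueBody K m r₀ := by
        show (fun j => (r₀ j : ℝ) + (m : ℝ) * realPoint (fun j => (n j - r₀ j) / ↑m) j) ∈ K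
        have : (fun j => (r₀ j : ℝ) + (m : ℝ) * realPoint (fun j => (n j - r₀ j) / ↑m) j) = realPoint n := by
          funext j
          simp only [realPoint]
          have := Int.mul_ediv_cancel' (hdvd j)
          have h' : ((r₀ j : ℤ) : ℝ) + ((m : ℤ) : ℝ) * (((n j - r₀ j) / m : ℤ) : ℝ) = ((n j : ℤ) : ℝ) := by
            exact_mod_cast (by linarith : r₀ j + (m : ℤ) * ((n j - r₀ j) / m) = n j)
          exact_mod_cast h'
        rw [this]; exact hnK
      refine Finset.mem_filter.mpr ⟨?_, hkK⟩
      have hb := residueBody_subset hm hKN hr hkK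
      refine Fintype.mem_piFinset.mpr fun j => Finset.mem_Icc.mpr ?_
      have h1 : (((-((N / m + 2 : ℕ) : ℤ) : ℤ) : ℝ)) ≤ (((n j - r₀ j) / m : ℤ) : ℝ) := by
        rw [Int.cast_neg, Int.cast_natCast]; exact hb.1 j
      have h2 : (((n j - r₀ j) / m : ℤ) : ℝ) ≤ (((N / m + 2 : ℕ) : ℤ) : ℝ) := by
        rw [Int.cast_natCast]; exact hb.2 j
      exact ⟨Int.cast_le.mp h1, Int.cast_le.mp h2⟩
    · funext j
      show r₀ j + (m : ℤ) * ((n j - r₀ j) / m) = n j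
      rw [Int.mul_ediv_cancel' (hdvd j)]; ring

open Classical in
/-- **Volume packing** (Green–Tao 2010, App. D, "by a volume packing argument similar to that
used to prove (A.1)"): for a weight `w` on `ℤ_m^d` bounded by `B` and a convex body
`K ⊆ [-N,N]^d`, `∑_{n ∈ K ∩ ℤ^d} w(n mod m) = vol(K) 𝔼_{ℤ_m^d} w + O_d(B m^d (N/m + 2)^{d-1})`.
[cite: GreenTao2010, App. D (proof of Thm. D.3, the display defining `α_{m_1,…,m_t}`)] -/
theorem sum_periodic_weight (hd : 1 ≤ d) : ∃ C : ℝ, 0 ≤ C ∧ ∀ N : ℕ, 1 ≤ N →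
    ∀ K : Set (Fin d → ℝ), Convex ℝ K → K ⊆ realBox d N → ∀ (m : ℕ) [NeZero m],
      ∀ (w : (Fin d → ZMod m) → ℝ) (B : ℝ), (∀ r, |w r| ≤ B) →
        |(∑ n ∈ (latticeBox d N).filter (fun n => realPoint n ∈ K), w (fun j => ((n j : ℤ) : ZMod m))) -
            (volume K).toReal * 𝔼 r, w r| ≤
          C * B * (m : ℝ) ^ d * ((N : ℝ) / m + 2) ^ (d - 1) := by
  obtain ⟨C₀, hC₀⟩ := GreenTao2010_latticePointsConvexBody_holds d hd
  have hC₀nn : 0 ≤ C₀ := by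
    have := hC₀ 1 le_rfl ∅ convex_empty (Set.empty_subset _)
    simp at this
    exact this
  refine ⟨C₀, hC₀nn, fun N hN K hK hKN m _ w B hw => ?_⟩
  have hm : 1 ≤ m := Nat.one_le_iff_ne_zero.mpr (NeZero.ne m)
  have hB : 0 ≤ B := (abs_nonneg _).trans (hw 0)
  set A := (latticeBox d N).filter (fun n => realPoint n ∈ K) with hA
  set π : (Fin d → ℤ) → (Fin d → ZMod m) := fun n j => ((n j : ℤ) : ZMod m) with hπ
  -- fibrewise
  have hfib : ∑ n ∈ A, w (π n) = ∑ r : Fin d → ZMod m, w r * ((A.filter fun n => π n = r).card : ℝ) := by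
    rw [← Finset.sum_fiberwise_of_maps_to (g := π) (t := Finset.univ) (fun _ _ => Finset.mem_univ _)]
    refine Finset.sum_congr rfl fun r _ => ?_
    rw [Finset.sum_congr rfl fun n hn => by rw [(Finset.mem_filter.mp hn).2], Finset.sum_const,
      nsmul_eq_mul, mul_comm]
  -- each fibre is a lattice point count
  set N' : ℕ := N / m + 2 with hN'
  have hcount : ∀ r : Fin d → ZMod m,
      |((A.filter fun n => π n = r).card : ℝ) - (volume K).toReal / (m : ℝ) ^ d| ≤ C₀ * (N' : ℝ) ^ (d - 1) := by
    intro r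
    rw [hA, card_filter_residue_eq hm hKN r]
    have hr : ∀ j, 0 ≤ (((r j).val : ℤ)) ∧ (((r j).val : ℤ)) < m := fun j =>
      ⟨by positivity, by exact_mod_cast ZMod.val_lt (r j)⟩
    have h := hC₀ N' (by rw [hN']; exact Nat.one_le_iff_ne_zero.mpr (Nat.succ_ne_zero _)) _
      (convex_residueBody hK m _) (residueBody_subset hm hKN hr)
    rw [volume_residueBody K hm, ENNReal.toReal_mul, ENNReal.toReal_ofReal (by positivity)] at h
    rwa [div_eq_inv_mul]
  -- assemble
  have hcard : (Fintype.card (Fin d → ZMod m) : ℝ) = (m : ℝ) ^ d := by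
    rw [Fintype.card_fun, ZMod.card, Fintype.card_fin]; push_cast; ring
  have hmain : (volume K).toReal * 𝔼 r, w r =
      ∑ r : Fin d → ZMod m, w r * ((volume K).toReal / (m : ℝ) ^ d) := by
    rw [Fintype.expect_eq_sum_div_card, hcard, ← Finset.sum_mul, mul_comm, div_mul_eq_mul_div,
      mul_div_assoc]
  have e1 : (∑ n ∈ A, w (π n)) - (volume K).toReal * 𝔼 r, w r =
      ∑ r : Fin d → ZMod m, (w r * ((A.filter fun n => π n = r).card : ℝ) -
        w r * ((volume K).toReal / (m : ℝ) ^ d)) := by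
    rw [hfib, hmain, ← Finset.sum_sub_distrib]
  show |(∑ n ∈ A, w (π n)) - (volume K).toReal * 𝔼 r, w r| ≤ _
  rw [e1]
  calc |∑ r : Fin d → ZMod m, (w r * ((A.filter fun n => π n = r).card : ℝ) -
          w r * ((volume K).toReal / (m : ℝ) ^ d))|
      ≤ ∑ r : Fin d → ZMod m, |w r * ((A.filter fun n => π n = r).card : ℝ) -
          w r * ((volume K).toReal / (m : ℝ) ^ d)| := Finset.abs_sum_le_sum_abs _ _
    _ ≤ ∑ _r : Fin d → ZMod m, B * (C₀ * (N' : ℝ) ^ (d - 1)) := Finset.sum_le_sum fun r _ => by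
        rw [← mul_sub, abs_mul]
        exact mul_le_mul (hw r) (hcount r) (abs_nonneg _) hB
    _ = C₀ * B * (m : ℝ) ^ d * (N' : ℝ) ^ (d - 1) := by
        rw [Finset.sum_const, Finset.card_univ, nsmul_eq_mul, hcard]; ring
    _ ≤ C₀ * B * (m : ℝ) ^ d * ((N : ℝ) / m + 2) ^ (d - 1) := by
        refine mul_le_mul_of_nonneg_left (pow_le_pow_left₀ (by positivity) ?_ _) (by positivity)
        rw [hN']; push_cast
        linarith [(Nat.cast_div_le (m := N) (n := m) : ((N / m : ℕ) : ℝ) ≤ N / m)]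

end volpacking


/-! ### Local densities and the volume packing step of Thm. D.3 -/

section localdensity

variable {d t : ℕ}

/-- The periodic weight `∏_i 1_{m_i | ψ_i(n)}` as a function on `ℤ_M^d`, `M = ∏ m_i`.
[cite: GreenTao2010, App. D (proof of Thm. D.3: "periodic with respect to the lattice `m · ℤ^d`")] -/
def divWeight (Ψ : Fin t → AffLinForm d) (m : Fin t → ℕ) (r : Fin d → ZMod (∏ i, m i)) : ℝ :=
  ∏ i, if (Ψ i).modEval (m i) (fun j => ZMod.castHom (Finset.dvd_prod_of_mem m (Finset.mem_univ i))
    (ZMod (m i)) (r j)) = 0 then 1 else 0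

/-- The local density `α_{m_1,…,m_t} = 𝔼_{n ∈ ℤ_M^d} ∏_i 1_{m_i | ψ_i(n)}`, `M = ∏ m_i`.
[cite: GreenTao2010, App. D (proof of Thm. D.3, definition of `α_{m_1,…,m_t}`)] -/
def localDensity (Ψ : Fin t → AffLinForm d) (m : Fin t → ℕ) [NeZero (∏ i, m i)] : ℝ :=
  𝔼 r : Fin d → ZMod (∏ i, m i), divWeight Ψ m r

/-- `0 ≤ divWeight ≤ 1`. [folklore] -/
theorem abs_divWeight_le (Ψ : Fin t → AffLinForm d) (m : Fin t → ℕ) (r : Fin d → ZMod (∏ i, m i)) :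
    |divWeight Ψ m r| ≤ 1 := by
  unfold divWeight
  rw [Finset.abs_prod]
  exact Finset.prod_le_one (fun _ _ => abs_nonneg _) fun i _ => by split_ifs <;> simp

/-- The periodic weight at the reduction of a lattice point. [folklore] -/
theorem divWeight_intCast (Ψ : Fin t → AffLinForm d) (m : Fin t → ℕ) (n : Fin d → ℤ) :
    divWeight Ψ m (fun j => ((n j : ℤ) : ZMod (∏ i, m i))) =
      ∏ i, if ((m i : ℕ) : ℤ) ∣ (Ψ i).eval n then (1 : ℝ) else 0 := by
  unfold divWeight
  refine Fintype.prod_congr _ _ fun i => ?_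
  have : (fun j => ZMod.castHom (Finset.dvd_prod_of_mem m (Finset.mem_univ i)) (ZMod (m i))
      (((n j : ℤ) : ZMod (∏ i, m i)))) = fun j => ((n j : ℤ) : ZMod (m i)) := by
    funext j; exact map_intCast _ _
  rw [this, ← AffLinForm.intCast_eval]
  simp only [ZMod.intCast_zmod_eq_zero_iff_dvd]

open Classical in
/-- **The volume packing step of Thm. D.3**:
`∑_{n ∈ K ∩ ℤ^d} ∏_i 1_{m_i | ψ_i(n)} = vol(K) α_{m_1,…,m_t} + O_d(M^d (N/M + 2)^{d-1})`, `M = ∏ m_i`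
(the source records `O(m N^{d-1})`). [cite: GreenTao2010, App. D (proof of Thm. D.3, the display
introducing `α_{m_1,…,m_t}`)] -/
theorem sum_divisibility_eq_volume (hd : 1 ≤ d) : ∃ C : ℝ, 0 ≤ C ∧ ∀ N : ℕ, 1 ≤ N →
    ∀ K : Set (Fin d → ℝ), Convex ℝ K → K ⊆ realBox d N →
      ∀ (Ψ : Fin t → AffLinForm d) (m : Fin t → ℕ) [NeZero (∏ i, m i)],
        |(∑ n ∈ (latticeBox d N).filter (fun n => realPoint n ∈ K),
            ∏ i, if ((m i : ℕ) : ℤ) ∣ (Ψ i).eval n then (1 : ℝ) else 0) -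
            (volume K).toReal * localDensity Ψ m| ≤
          C * ((∏ i, m i : ℕ) : ℝ) ^ d * ((N : ℝ) / (∏ i, m i : ℕ) + 2) ^ (d - 1) := by
  obtain ⟨C, hC0, hC⟩ := sum_periodic_weight (d := d) hd
  refine ⟨C, hC0, fun N hN K hK hKN Ψ m _ => ?_⟩
  have h := hC N hN K hK hKN (∏ i, m i) (divWeight Ψ m) 1 (abs_divWeight_le Ψ m)
  simp_rw [divWeight_intCast] at h
  unfold localDensity
  simpa using h

/-- `modEval` commutes with ring homomorphisms `ℤ_M → ℤ_{M'}`. [folklore] -/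
theorem map_modEval {M M' : ℕ} (f : ZMod M →+* ZMod M') (ψ : AffLinForm d) (v : Fin d → ZMod M) :
    f (ψ.modEval M v) = ψ.modEval M' (fun j => f (v j)) := by
  unfold AffLinForm.modEval
  rw [map_add, map_sum, map_intCast]
  congr 1
  exact Finset.sum_congr rfl fun j _ => by rw [map_mul, map_intCast]

/-- Vanishing modulo a product of coprime moduli. [folklore] -/
theorem zmod_eq_zero_iff_of_coprime {a b : ℕ} (h : a.Coprime b) (x : ZMod (a * b)) :
    x = 0 ↔ (ZMod.castHom (dvd_mul_right a b) (ZMod a) x = 0 ∧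
      ZMod.castHom (dvd_mul_left b a) (ZMod b) x = 0) := by
  constructor
  · rintro rfl; simp
  · rintro ⟨h1, h2⟩
    apply (ZMod.chineseRemainder h).injective
    rw [map_zero]
    show (ZMod.castHom (Nat.lcm_dvd_iff.mpr ⟨dvd_mul_right a b, dvd_mul_left b a⟩) (ZMod a × ZMod b)) x = 0
    rw [ZMod.castHom_apply] at h1 h2 ⊢
    ext
    · rw [Prod.fst_zmod_cast]; exact h1
    · rw [Prod.snd_zmod_cast]; exact h2

/-- The first CRT component is the reduction. [folklore] -/
theorem chineseRemainder_fst {a b : ℕ} (h : a.Coprime b) (x : ZMod (a * b)) :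
    (ZMod.chineseRemainder h x).1 = ZMod.castHom (dvd_mul_right a b) (ZMod a) x := by
  show ((ZMod.castHom (Nat.lcm_dvd_iff.mpr ⟨dvd_mul_right a b, dvd_mul_left b a⟩) (ZMod a × ZMod b)) x).1 = _
  rw [ZMod.castHom_apply, ZMod.castHom_apply, Prod.fst_zmod_cast]

/-- The second CRT component is the reduction. [folklore] -/
theorem chineseRemainder_snd {a b : ℕ} (h : a.Coprime b) (x : ZMod (a * b)) :
    (ZMod.chineseRemainder h x).2 = ZMod.castHom (dvd_mul_left b a) (ZMod b) x := by
  show ((ZMod.castHom (Nat.lcm_dvd_iff.mpr ⟨dvd_mul_right a b, dvd_mul_left b a⟩) (ZMod a × ZMod b)) x).2 = _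
  rw [ZMod.castHom_apply, ZMod.castHom_apply, Prod.snd_zmod_cast]

/-- Composition of reductions. [folklore] -/
theorem castHom_castHom {n m k : ℕ} (hm : n ∣ m) (hd : m ∣ k) (x : ZMod k) :
    ZMod.castHom hm (ZMod n) (ZMod.castHom hd (ZMod m) x) = ZMod.castHom (hm.trans hd) (ZMod n) x := by
  have := ZMod.castHom_comp hm hd
  exact (RingHom.congr_fun this x : _)

/-- Reduction of a reduction, through `val`: for `k ∣ M` and `x : ℤ_P` (any `P`, `M` nonzero),
`((x.val mod M) : ℤ_k) = (x.val : ℤ_k)`. [folklore] -/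
theorem natCast_mod_of_dvd {k M : ℕ} (h : k ∣ M) (a : ℕ) : ((a % M : ℕ) : ZMod k) = (a : ZMod k) := by
  have h1 := Nat.mod_add_div a M
  have h2 : ((M : ℕ) : ZMod k) = 0 := (ZMod.natCast_eq_zero_iff M k).mpr h
  calc ((a % M : ℕ) : ZMod k) = ((a % M : ℕ) : ZMod k) + (M : ZMod k) * ((a / M : ℕ) : ZMod k) := by
        rw [h2, zero_mul, add_zero]
    _ = ((a % M + M * (a / M) : ℕ) : ZMod k) := by push_cast; ring
    _ = (a : ZMod k) := by rw [h1]

/-- An indicator of a conjunction is a product of indicators. [folklore] -/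
theorem ite_and_eq_mul {p q : Prop} [Decidable p] [Decidable q] :
    (if p ∧ q then (1 : ℝ) else 0) = (if p then 1 else 0) * (if q then 1 else 0) := by
  by_cases hp : p <;> by_cases hq : q <;> simp [hp, hq]

/-- **Multiplicativity of the local densities** ("from the Chinese remainder theorem we make the
key observation that `α_{m_1,…,m_t}` is multiplicative"): for `gcd(∏ m_i, ∏ m'_i) = 1`,
`α_{m_1 m'_1,…,m_t m'_t} = α_{m_1,…,m_t} α_{m'_1,…,m'_t}`.
[cite: GreenTao2010, App. D (proof of Thm. D.3, the display `α_{m_1,…,m_t} = ∏_p α_{p^{r_{p,1}},…,p^{r_{p,t}}}`)] -/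
theorem localDensity_mul (Ψ : Fin t → AffLinForm d) (m m' : Fin t → ℕ) [NeZero (∏ i, m i)]
    [NeZero (∏ i, m' i)] [NeZero (∏ i, (m i * m' i))]
    (hcop : Nat.Coprime (∏ i, m i) (∏ i, m' i)) :
    localDensity Ψ (fun i => m i * m' i) = localDensity Ψ m * localDensity Ψ m' := by
  classical
  have hprod : (∏ i, (m i * m' i)) = (∏ i, m i) * (∏ i, m' i) := Finset.prod_mul_distrib
  haveI hPne : NeZero ((∏ i, m i) * (∏ i, m' i)) := ⟨by rw [← hprod]; exact NeZero.ne _⟩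
  -- the CRT equivalence on vectors
  let E : ZMod (∏ i, (m i * m' i)) ≃+* ZMod (∏ i, m i) × ZMod (∏ i, m' i) :=
    (ZMod.ringEquivCongr hprod).trans (ZMod.chineseRemainder hcop)
  let eV : (Fin d → ZMod (∏ i, (m i * m' i))) ≃ (Fin d → ZMod (∏ i, m i)) × (Fin d → ZMod (∏ i, m' i)) :=
    (Equiv.arrowCongr (Equiv.refl (Fin d)) E.toEquiv).trans (Equiv.arrowProdEquivProdArrow _ _ _)
  -- divisibilities
  have hdm : ∀ i, m i ∣ ∏ i, m i := fun i => Finset.dvd_prod_of_mem m (Finset.mem_univ i)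
  have hdm' : ∀ i, m' i ∣ ∏ i, m' i := fun i => Finset.dvd_prod_of_mem m' (Finset.mem_univ i)
  have hdP : ∀ i, m i * m' i ∣ ∏ i, (m i * m' i) := fun i =>
    Finset.dvd_prod_of_mem (fun i => m i * m' i) (Finset.mem_univ i)
  have hcopi : ∀ i, (m i).Coprime (m' i) := fun i =>
    Nat.Coprime.of_dvd (hdm i) (hdm' i) hcop
  -- the reductions through the equivalence
  have hE1 : ∀ i (x : ZMod (∏ i, (m i * m' i))),
      ZMod.castHom (hdm i) (ZMod (m i)) (E x).1 =
        ZMod.castHom ((dvd_mul_right (m i) (m' i)).trans (hdP i)) (ZMod (m i)) x := by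
    intro i x
    haveI : NeZero (m i) := ⟨fun h => NeZero.ne (∏ i, m i) (Finset.prod_eq_zero (Finset.mem_univ i) h)⟩
    have h1 : (E x).1 = ZMod.castHom (dvd_mul_right _ _) (ZMod (∏ i, m i)) (ZMod.ringEquivCongr hprod x) :=
      chineseRemainder_fst hcop _
    rw [h1, ZMod.castHom_apply, ZMod.castHom_apply, ZMod.castHom_apply, ZMod.cast_eq_val,
      ZMod.cast_eq_val, ZMod.cast_eq_val, ZMod.val_natCast, ZMod.ringEquivCongr_val,
      natCast_mod_of_dvd (hdm i)]
  have hE2 : ∀ i (x : ZMod (∏ i, (m i * m' i))),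
      ZMod.castHom (hdm' i) (ZMod (m' i)) (E x).2 =
        ZMod.castHom ((dvd_mul_left (m' i) (m i)).trans (hdP i)) (ZMod (m' i)) x := by
    intro i x
    haveI : NeZero (m' i) := ⟨fun h => NeZero.ne (∏ i, m' i) (Finset.prod_eq_zero (Finset.mem_univ i) h)⟩
    have h1 : (E x).2 = ZMod.castHom (dvd_mul_left _ _) (ZMod (∏ i, m' i)) (ZMod.ringEquivCongr hprod x) :=
      chineseRemainder_snd hcop _
    rw [h1, ZMod.castHom_apply, ZMod.castHom_apply, ZMod.castHom_apply, ZMod.cast_eq_val,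
      ZMod.cast_eq_val, ZMod.cast_eq_val, ZMod.val_natCast, ZMod.ringEquivCongr_val,
      natCast_mod_of_dvd (hdm' i)]
  -- pointwise factorisation of the weight
  have hw : ∀ r : Fin d → ZMod (∏ i, (m i * m' i)),
      divWeight Ψ (fun i => m i * m' i) r = divWeight Ψ m (eV r).1 * divWeight Ψ m' (eV r).2 := by
    intro r
    unfold divWeight
    rw [← Finset.prod_mul_distrib]
    refine Fintype.prod_congr _ _ fun i => ?_
    rw [← ite_and_eq_mul]
    have key : ((Ψ i).modEval (m i * m' i) fun j => ZMod.castHom (hdP i) (ZMod (m i * m' i)) (r j)) = 0 ↔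
        ((Ψ i).modEval (m i) fun j => ZMod.castHom (hdm i) (ZMod (m i)) ((eV r).1 j)) = 0 ∧
        ((Ψ i).modEval (m' i) fun j => ZMod.castHom (hdm' i) (ZMod (m' i)) ((eV r).2 j)) = 0 := by
      rw [zmod_eq_zero_iff_of_coprime (hcopi i), map_modEval, map_modEval]
      have h1 : (fun j => ZMod.castHom (dvd_mul_right (m i) (m' i)) (ZMod (m i))
          (ZMod.castHom (hdP i) (ZMod (m i * m' i)) (r j))) =
          fun j => ZMod.castHom (hdm i) (ZMod (m i)) ((eV r).1 j) := by
        funext j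
        rw [castHom_castHom]
        exact (hE1 i (r j)).symm
      have h2 : (fun j => ZMod.castHom (dvd_mul_left (m' i) (m i)) (ZMod (m' i))
          (ZMod.castHom (hdP i) (ZMod (m i * m' i)) (r j))) =
          fun j => ZMod.castHom (hdm' i) (ZMod (m' i)) ((eV r).2 j) := by
        funext j
        rw [castHom_castHom]
        exact (hE2 i (r j)).symm
      rw [h1, h2]
    simp only [key]
  -- average over the equivalence
  unfold localDensity
  rw [Fintype.expect_equiv eV _ (fun p => divWeight Ψ m p.1 * divWeight Ψ m' p.2) (fun r => hw r),
    ← Finset.univ_product_univ,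
    Finset.expect_product' (f := fun x y => divWeight Ψ m x * divWeight Ψ m' y)]
  simp_rw [← Finset.mul_expect]
  rw [← Finset.expect_mul]

end localdensity

end Literature.NumberTheory.Sieve
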